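import Summits.AtomisticToContinuum.FouriersLaw.Theses.BondHeatUncertainty
import Literature.MathematicalPhysics.KineticTheory.LangevinChainReversal
import Literature.Probability.Entropy.FluctuationTheoremUncertainty
import Summits.AtomisticToContinuum.FouriersLaw.Theorems.BondHeatUncertaintyDefs
import Summits.AtomisticToContinuum.FouriersLaw.Theorems.BondHeatUncertaintyLinearResponseFTURFiniteBiasClausiusHelper1
import Summits.AtomisticToContinuum.FouriersLaw.Theorems.BondHeatUncertaintyLinearResponseFTURFiniteBiasClausiusHelper2
import Summits.AtomisticToContinuum.FouriersLaw.Theorems.BondHeatUncertaintyLinearResponseFTURFiniteBiasClausiusHelper3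
import Summits.AtomisticToContinuum.FouriersLaw.Theorems.BondHeatUncertaintyLinearResponseFTURFiniteBiasClausiusHelper4
import Summits.AtomisticToContinuum.FouriersLaw.Theorems.BondHeatUncertaintyLinearResponseFTURFiniteBiasClausiusHelper5

/-!
# Stub `stub_finiteBiasClausius` of line `lebesgue-flip-duality` (crux ★ `LinearResponseFTUR`, stmt-AtomisticToContinuum-9122) — finite-bias Clausius from GDB

Target: `Summits/AtomisticToContinuum/FouriersLaw/Theorems/BondHeatUncertaintyLinearResponseFTURFiniteBiasClausius.lean`.
Proof (the transient fluctuation theorem from the Gibbs start at `T_R`, NO NESS density): let `μ` be a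
weak steady state (`N ≥ 2`) and `ν = Z⁻¹e^{-H/T_R} dz` the Gibbs measure at the RIGHT temperature.
(1) The heat-flux detailed balance (hypothesis, = K1 + K3 of the line) tested against `F = ρ_{T_R}(x_t)`
and the pathwise energy balance `H(x_t) - H(x_0) = Q_L + Q_R` (helper 1) give the integral fluctuation
theorem `E_{ν⊗W} e^{-cQ_{L,t}} = 1`, `c = 1/T_R - 1/T_L` (helper 5), hence `0 ≤ c·E_{ν⊗W} Q_{L,t}` for
EVERY `t > 0` (`e^{-x} ≥ 1 - x`; integrability from the uniform exponential moments of helper 4 and the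
Fubini identity of helper 5): `clausius_second_law_at_time`, with
`E Q_{L,t} = ½E p_0(t)² - ½ν(p_0²) + ∫₀ᵗ (νP_s)(ψ) ds`, `ψ = p_0 ∂_{q_0}H`, `E p_0(t)²` bounded in `t`.
(2) Krylov–Bogoliubov–Cesàro from `ν` (helper 2): along a subsequence the Cesàro averages of `νP_s`
converge weakly to an invariant probability measure with an exponential moment, a weak steady state
(`pinnedChain_isSteadyState_of_isInvariant`), hence `= μ` by uniqueness; the limit extends to the
unbounded `ψ` (helper 3). (3) Dividing (1) by `t` along the subsequence gives `0 ≤ c·μ(ψ)`, i.e.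
`0 ≤ (T_L - T_R)·μ(ψ)` after multiplication by `T_L T_R > 0`.
-/

noncomputable section

namespace Summit.AtomisticToContinuum.FouriersLaw.Theorems.LinearResponseFTUR

open MeasureTheory ProbabilityTheory Filter Topology Set
open scoped NNReal ENNReal
open Literature.MathematicalPhysics.KineticTheory Literature.MathematicalPhysics.KineticTheory.HeatConduction
open Literature.Probability.Process Summit.AtomisticToContinuum.FouriersLaw.Theorems.BondHeatUncertainty

/-- **The density factor of the Gibbs start after the flip**: `ρ_T((Θ̃ obs).x_t) = ρ_T(Θ x_0) = ρ_T(x_0)`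
(`H` is even in the momenta). -/
theorem clausius_gibbsDensity_flipObs (P : OscillatorChain) {N : ℕ} (T : ℝ) (i0 iN ib : Fin N)
    (t : ℝ) (z : PhaseSpace N) (X : ℝ → PhaseSpace N) :
    ENNReal.ofReal (P.gibbsDensity N T (flipObs N (rawObs P N i0 iN ib t z X)).2.1) =
      ENNReal.ofReal (P.gibbsDensity N T z) := by
  show ENNReal.ofReal (Real.exp (-P.hamiltonian N (z.1, -z.2) / T)) =
    ENNReal.ofReal (Real.exp (-P.hamiltonian N z / T))
  rw [OscillatorChain.hamiltonian_neg_momentum]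

/-- **The entropy production of the transient fluctuation theorem has no boundary term**: along the
forward path from `z`, `e^{Q_L/T_L + Q_R/T_R} ρ_{T_R}(x_t) = ρ_{T_R}(z) e^{-(1/T_R - 1/T_L) Q_L}` by the
pathwise energy balance `H(x_t) = H(z) + Q_L + Q_R` (helper 1). -/
theorem clausius_tilt_identity {ω₂ lam β γ : ℝ} (hω : 0 < ω₂) (hl : 0 ≤ lam) (hβ : 0 ≤ β)
    (hγ : 0 ≤ γ) {N : ℕ} (i0 iN ib : Fin N) (hN : 2 ≤ N) (hi0 : i0.val = 0) (hiN : iN.val = N - 1)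
    (T_L T_R : ℝ) {t : ℝ} (ht : 0 ≤ t) (z : PhaseSpace N) (w : WienerPair) :
    ENNReal.ofReal (Real.exp
        (leftHeat i0 (rawObs (pinnedChain ω₂ lam β γ) N i0 iN ib t z
            (fwdPath (pinnedChain ω₂ lam β γ) N T_L T_R z w)) / T_L +
          rightHeat iN (rawObs (pinnedChain ω₂ lam β γ) N i0 iN ib t z
            (fwdPath (pinnedChain ω₂ lam β γ) N T_L T_R z w)) / T_R)) *
      ENNReal.ofReal ((pinnedChain ω₂ lam β γ).gibbsDensity N T_R
        (rawObs (pinnedChain ω₂ lam β γ) N i0 iN ib t z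
          (fwdPath (pinnedChain ω₂ lam β γ) N T_L T_R z w)).2.1) =
    ENNReal.ofReal ((pinnedChain ω₂ lam β γ).gibbsDensity N T_R z) *
      ENNReal.ofReal (Real.exp (-((1 / T_R - 1 / T_L) *
        leftHeat i0 (rawObs (pinnedChain ω₂ lam β γ) N i0 iN ib t z
          (fwdPath (pinnedChain ω₂ lam β γ) N T_L T_R z w))))) := by
  have hb := clausius_fwdPath_energy_balance ω₂ lam β γ hω hl hβ hγ N i0 iN ib hN hi0 hiN T_L T_R t
    ht z w
  rw [← ENNReal.ofReal_mul (Real.exp_pos _).le,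
    ← ENNReal.ofReal_mul ((pinnedChain ω₂ lam β γ).gibbsDensity_pos N T_R z).le]
  congr 1
  show Real.exp _ * Real.exp (-(pinnedChain ω₂ lam β γ).hamiltonian N
      (fwdPath (pinnedChain ω₂ lam β γ) N T_L T_R z w t) / T_R) =
    Real.exp (-(pinnedChain ω₂ lam β γ).hamiltonian N z / T_R) * Real.exp _
  rw [← Real.exp_add, ← Real.exp_add]
  congr 1
  have hH : (pinnedChain ω₂ lam β γ).hamiltonian N (fwdPath (pinnedChain ω₂ lam β γ) N T_L T_R z w t) =
      (pinnedChain ω₂ lam β γ).hamiltonian N z +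
        (leftHeat i0 (rawObs (pinnedChain ω₂ lam β γ) N i0 iN ib t z
            (fwdPath (pinnedChain ω₂ lam β γ) N T_L T_R z w)) +
          rightHeat iN (rawObs (pinnedChain ω₂ lam β γ) N i0 iN ib t z
            (fwdPath (pinnedChain ω₂ lam β γ) N T_L T_R z w))) := by
    linarith
  rw [hH]
  ring

/-- **The second law at time `t` for the Gibbs start at `T_R`** (steps (1)–(2) of the proof of
`stub_finiteBiasClausius`): from the heat-flux detailed balance, for the pinned chain (`N ≥ 2`, all
parameters positive), uniform exponential moments `∫ e^{ϑH} d(νP_s) ≤ M < ∞` along the orbit of the Gibbs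
measure `ν` at `T_R`, and polynomial bounds `p_0², |p_0 ∂_{q_0}H| ≤ K e^{ϑH}`: for every `t > 0` there
are `a = E p_0(t)²`, `b = ν(p_0²)`, both of modulus `≤ K M`, with
`0 ≤ (1/T_R - 1/T_L)·(a/2 - b/2 + ∫₀ᵗ (νP_s)(p_0 ∂_{q_0}H) ds)` — the integral fluctuation theorem
`E_{ν⊗W} e^{-(1/T_R-1/T_L)Q_{L,t}} = 1` (GDB tested against `ρ_{T_R}(x_t)`, `clausius_tilt_identity`,
`clausius_lintegral_gibbs_prod_eq_one`), the pointwise inequality `e^{-x} ≥ 1 - x`, and Fubini. -/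
theorem clausius_second_law_at_time
    (hGDB : ∀ ω₂ lam β γ : ℝ, 0 < ω₂ → 0 < lam → 0 < β → 0 < γ →
      ∀ (N : ℕ) (i0 iN ib : Fin N), 2 ≤ N → i0.val = 0 → iN.val = N - 1 →
      ∀ (T_L T_R : ℝ), 0 < T_L → 0 < T_R → ∀ t : ℝ, 0 < t →
      ∀ F : Obs N → ℝ≥0∞, Measurable F →
        ∫⁻ z, ∫⁻ w, F (flipObs N (rawObs (pinnedChain ω₂ lam β γ) N i0 iN ib t z
            (fwdPath (pinnedChain ω₂ lam β γ) N T_L T_R z w))) ∂wienerPair =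
          ∫⁻ z, ∫⁻ w, ENNReal.ofReal (Real.exp
              (leftHeat i0 (rawObs (pinnedChain ω₂ lam β γ) N i0 iN ib t z
                  (fwdPath (pinnedChain ω₂ lam β γ) N T_L T_R z w)) / T_L +
                rightHeat iN (rawObs (pinnedChain ω₂ lam β γ) N i0 iN ib t z
                  (fwdPath (pinnedChain ω₂ lam β γ) N T_L T_R z w)) / T_R)) *
            F (rawObs (pinnedChain ω₂ lam β γ) N i0 iN ib t z
              (fwdPath (pinnedChain ω₂ lam β γ) N T_L T_R z w)) ∂wienerPair)
    {ω₂ lam β γ : ℝ} (hω : 0 < ω₂) (hl : 0 < lam) (hβ : 0 < β) (hγ : 0 < γ) {N : ℕ}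
    (i0 iN : Fin N) (hN : 2 ≤ N) (hi0 : i0.val = 0) (hiN : iN.val = N - 1) {T_L T_R : ℝ}
    (hTL : 0 < T_L) (hTR : 0 < T_R) {ϑ : ℝ} {M : ℝ≥0∞} (hMtop : M ≠ ⊤)
    (hM : ∀ s : ℝ≥0, ∫⁻ y, ENNReal.ofReal (Real.exp (ϑ * (pinnedChain ω₂ lam β γ).hamiltonian N y))
      ∂(((pinnedChain ω₂ lam β γ).gibbsMeasure N T_R).bind
        ((pinnedChain ω₂ lam β γ).transitionKernel N T_L T_R s)) ≤ M)
    {K : ℝ≥0} (hK : ∀ x : PhaseSpace N,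
      x.2 i0 ^ 2 ≤ K * Real.exp (ϑ * (pinnedChain ω₂ lam β γ).hamiltonian N x) ∧
      |x.2 i0 * partialQ i0 ((pinnedChain ω₂ lam β γ).hamiltonian N) x| ≤
        K * Real.exp (ϑ * (pinnedChain ω₂ lam β γ).hamiltonian N x))
    {t : ℝ} (ht : 0 < t) :
    ∃ a b : ℝ, |a| ≤ K * M.toReal ∧ |b| ≤ K * M.toReal ∧
      0 ≤ (1 / T_R - 1 / T_L) * (a / 2 - b / 2 + ∫ s in (0:ℝ)..t,
        ∫ y, y.2 i0 * partialQ i0 ((pinnedChain ω₂ lam β γ).hamiltonian N) y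
          ∂(((pinnedChain ω₂ lam β γ).gibbsMeasure N T_R).bind
            ((pinnedChain ω₂ lam β γ).transitionKernel N T_L T_R s.toNNReal))) := by
  -- (GDB) tested against `F = ρ_{T_R}(x_t)`
  have hgc : Continuous ((pinnedChain ω₂ lam β γ).gibbsDensity N T_R) :=
    pinnedChain_continuous_gibbsDensity ω₂ lam β γ N T_R
  have hF : Measurable fun p : Obs N =>
      ENNReal.ofReal ((pinnedChain ω₂ lam β γ).gibbsDensity N T_R p.2.1) :=
    (hgc.measurable.comp (measurable_fst.comp measurable_snd)).ennreal_ofReal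
  have hkey := hGDB ω₂ lam β γ hω hl hβ hγ N i0 iN i0 hN hi0 hiN T_L T_R hTL hTR t ht _ hF
  clear hGDB
  simp only [clausius_gibbsDensity_flipObs, lintegral_const, measure_univ, mul_one,
    clausius_tilt_identity hω hl.le hβ.le hγ.le i0 iN i0 hN hi0 hiN T_L T_R ht.le] at hkey
  -- notation
  set P := pinnedChain ω₂ lam β γ with hP
  set ν : Measure (PhaseSpace N) := P.gibbsMeasure N T_R with hν
  haveI hνP : IsProbabilityMeasure ν :=
    pinnedChain_isProbabilityMeasure_gibbsMeasure hω hl.le hβ.le γ N hTR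
  set κ := P.transitionKernel N T_L T_R with hκ
  haveI hκM : ∀ s, IsMarkovKernel (κ s) := fun s =>
    pinnedChain_isMarkovKernel_transitionKernel hω hl.le hβ.le hγ.le N T_L T_R s
  set c : ℝ := 1 / T_R - 1 / T_L with hc
  -- the integral fluctuation theorem under `ν ⊗ W`
  have hmL : Measurable (leftHeat (N := N) i0) := by unfold leftHeat; fun_prop
  have hobs := clausius_measurable_rawObs hω hl.le hβ.le hγ.le N T_L T_R i0 iN i0 t
  have hσm : Measurable fun zw : PhaseSpace N × WienerPair =>
      c * leftHeat i0 (rawObs P N i0 iN i0 t zw.1 (fwdPath P N T_L T_R zw.1 zw.2)) :=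
    (hmL.comp hobs).const_mul c
  have hEm : Measurable fun zw : PhaseSpace N × WienerPair => ENNReal.ofReal (Real.exp
      (-(c * leftHeat i0 (rawObs P N i0 iN i0 t zw.1 (fwdPath P N T_L T_R zw.1 zw.2))))) :=
    (Real.measurable_exp.comp hσm.neg).ennreal_ofReal
  have hone := clausius_lintegral_gibbs_prod_eq_one hω hl.le hβ.le γ N hTR hEm hkey.symm
  -- integrability of the three pieces of `Q_L = p_0(t)²/2 - p_0(0)²/2 + ∫₀ᵗ ψ(X_s) ds`
  have hψc : Continuous fun y : PhaseSpace N => y.2 i0 * partialQ i0 (P.hamiltonian N) y :=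
    ((continuous_apply i0).comp continuous_snd).mul
      (P.continuous_partialQ_hamiltonian (pinnedChain_contDiff_hamiltonian ω₂ lam β γ N) i0)
  have hp2m : Measurable fun y : PhaseSpace N => y.2 i0 ^ 2 := by fun_prop
  have hp2K : ∀ y : PhaseSpace N, |y.2 i0 ^ 2| ≤ K * Real.exp (ϑ * P.hamiltonian N y) := fun y => by
    rw [abs_of_nonneg (sq_nonneg _)]; exact (hK y).1
  have hA := clausius_integral_comp_fwdPath hω hl.le hβ.le hγ.le N T_L T_R ν t hp2m
  beta_reduce at hA
  have hA' := clausius_integrable_of_le_exp (ρ := ν.bind (κ t.toNNReal)) hMtop (hM _) hp2m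
    K.coe_nonneg hp2K
  have hB := clausius_integral_comp_fwdPath hω hl.le hβ.le hγ.le N T_L T_R ν 0 hp2m
  beta_reduce at hB
  have hB' := clausius_integrable_of_le_exp (ρ := ν.bind (κ (0:ℝ).toNNReal)) hMtop (hM _) hp2m
    K.coe_nonneg hp2K
  have hB0 : ∀ zw : PhaseSpace N × WienerPair, fwdPath P N T_L T_R zw.1 zw.2 0 = zw.1 := fun zw =>
    pinnedChain_solMap_of_nonpos N T_L T_R zw.1 (pairPath zw.2) le_rfl
  have hC := clausius_workIntegral_fubini hω hl.le hβ.le hγ.le N T_L T_R ν hMtop hM hψc K.coe_nonneg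
    (fun y => (hK y).2) ht.le
  have hintA : Integrable (fun zw : PhaseSpace N × WienerPair =>
      (fwdPath P N T_L T_R zw.1 zw.2 t).2 i0 ^ 2 / 2) (ν.prod wienerPair) := (hA.1.2 hA'.1).div_const 2
  have hintB : Integrable (fun zw : PhaseSpace N × WienerPair => zw.1.2 i0 ^ 2 / 2)
      (ν.prod wienerPair) := by
    refine ((hB.1.2 hB'.1).div_const 2).congr (ae_of_all _ fun zw => ?_)
    show (fwdPath P N T_L T_R zw.1 zw.2 0).2 i0 ^ 2 / 2 = zw.1.2 i0 ^ 2 / 2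
    rw [hB0 zw]
  have hintAB : Integrable (fun zw : PhaseSpace N × WienerPair =>
      (fwdPath P N T_L T_R zw.1 zw.2 t).2 i0 ^ 2 / 2 - zw.1.2 i0 ^ 2 / 2) (ν.prod wienerPair) :=
    hintA.sub hintB
  have hintC : Integrable (fun zw : PhaseSpace N × WienerPair =>
      ∫ s in (0:ℝ)..t, (fwdPath P N T_L T_R zw.1 zw.2 s).2 i0 *
        partialQ i0 (P.hamiltonian N) (fwdPath P N T_L T_R zw.1 zw.2 s)) (ν.prod wienerPair) := hC.1
  have hCeq : ∫ zw, (∫ s in (0:ℝ)..t, (fwdPath P N T_L T_R zw.1 zw.2 s).2 i0 *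
        partialQ i0 (P.hamiltonian N) (fwdPath P N T_L T_R zw.1 zw.2 s)) ∂(ν.prod wienerPair) =
      ∫ s in (0:ℝ)..t, ∫ y, y.2 i0 * partialQ i0 (P.hamiltonian N) y ∂(ν.bind (κ s.toNNReal)) :=
    hC.2
  have hσ_eq : (fun zw : PhaseSpace N × WienerPair =>
      c * leftHeat i0 (rawObs P N i0 iN i0 t zw.1 (fwdPath P N T_L T_R zw.1 zw.2))) =
      fun zw => c * ((fwdPath P N T_L T_R zw.1 zw.2 t).2 i0 ^ 2 / 2 - zw.1.2 i0 ^ 2 / 2 +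
        ∫ s in (0:ℝ)..t, (fwdPath P N T_L T_R zw.1 zw.2 s).2 i0 *
          partialQ i0 (P.hamiltonian N) (fwdPath P N T_L T_R zw.1 zw.2 s)) := rfl
  have hintσ : Integrable (fun zw : PhaseSpace N × WienerPair =>
      c * leftHeat i0 (rawObs P N i0 iN i0 t zw.1 (fwdPath P N T_L T_R zw.1 zw.2))) (ν.prod wienerPair) := by
    rw [hσ_eq]
    exact (hintAB.add hintC).const_mul c
  -- the value of `E σ`
  have hval : ∫ zw, c * leftHeat i0 (rawObs P N i0 iN i0 t zw.1 (fwdPath P N T_L T_R zw.1 zw.2))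
      ∂(ν.prod wienerPair) =
      c * ((∫ zw, (fwdPath P N T_L T_R zw.1 zw.2 t).2 i0 ^ 2 ∂(ν.prod wienerPair)) / 2 -
        (∫ zw : PhaseSpace N × WienerPair, zw.1.2 i0 ^ 2 ∂(ν.prod wienerPair)) / 2 +
        ∫ s in (0:ℝ)..t, ∫ y, y.2 i0 * partialQ i0 (P.hamiltonian N) y ∂(ν.bind (κ s.toNNReal))) := by
    rw [hσ_eq, integral_const_mul, integral_add hintAB hintC, integral_sub hintA hintB, integral_div,
      integral_div, hCeq]
  -- the second law at time `t`
  have hpos := integral_nonneg_of_lintegral_exp_neg_eq_one hintσ hone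
  rw [hval] at hpos
  refine ⟨∫ zw, (fwdPath P N T_L T_R zw.1 zw.2 t).2 i0 ^ 2 ∂(ν.prod wienerPair),
    ∫ zw : PhaseSpace N × WienerPair, zw.1.2 i0 ^ 2 ∂(ν.prod wienerPair), ?_, ?_, hpos⟩
  · rw [hA.2]; exact hA'.2
  · have h : ∫ zw : PhaseSpace N × WienerPair, zw.1.2 i0 ^ 2 ∂(ν.prod wienerPair) =
        ∫ zw, (fwdPath P N T_L T_R zw.1 zw.2 0).2 i0 ^ 2 ∂(ν.prod wienerPair) :=
      integral_congr_ae (ae_of_all _ fun zw => by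
        show zw.1.2 i0 ^ 2 = (fwdPath P N T_L T_R zw.1 zw.2 0).2 i0 ^ 2
        rw [hB0 zw])
    rw [h, hB.2]; exact hB'.2

/-- **Finite-bias Clausius inequality, injected-power form, from the heat-flux detailed balance**
(stub `stub_finiteBiasClausius` of line `lebesgue-flip-duality`, crux `LinearResponseFTUR`): under
weak-NESS uniqueness, for every weak steady state `μ` of the `N`-site pinned chain (`N ≥ 2`, all
parameters positive) at `T_L, T_R > 0`, the mean work rate of the left thermostatted momentum against
the force has the sign of `T_L - T_R`: `0 ≤ (T_L - T_R) ∫ p_0 ∂_{q_0}H dμ`. Proved by the transient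
fluctuation theorem from the Gibbs start at `T_R` (`clausius_second_law_at_time`:
`(1/T_R - 1/T_L) E Q_{L,t} ≥ 0` for all `t`), the Cesàro ergodic limit `t⁻¹ E Q_{L,t} → μ(p_0 ∂_{q_0}H)`
along a Krylov–Bogoliubov subsequence (helpers 2–4), and uniqueness of the weak steady state; see the
module docstring. -/
theorem stub_finiteBiasClausius :
    (∀ ω₂ lam β γ : ℝ, 0 < ω₂ → 0 < lam → 0 < β → 0 < γ →
  ∀ (N : ℕ) (i0 iN ib : Fin N), 2 ≤ N → i0.val = 0 → iN.val = N - 1 →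
  ∀ (T_L T_R : ℝ), 0 < T_L → 0 < T_R → ∀ t : ℝ, 0 < t →
  ∀ F : Obs N → ℝ≥0∞, Measurable F →
    ∫⁻ z, ∫⁻ w, F (flipObs N (rawObs (pinnedChain ω₂ lam β γ) N i0 iN ib t z
        (fwdPath (pinnedChain ω₂ lam β γ) N T_L T_R z w))) ∂wienerPair =
      ∫⁻ z, ∫⁻ w, ENNReal.ofReal (Real.exp
          (leftHeat i0 (rawObs (pinnedChain ω₂ lam β γ) N i0 iN ib t z
              (fwdPath (pinnedChain ω₂ lam β γ) N T_L T_R z w)) / T_L +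
            rightHeat iN (rawObs (pinnedChain ω₂ lam β γ) N i0 iN ib t z
              (fwdPath (pinnedChain ω₂ lam β γ) N T_L T_R z w)) / T_R)) *
        F (rawObs (pinnedChain ω₂ lam β γ) N i0 iN ib t z
          (fwdPath (pinnedChain ω₂ lam β γ) N T_L T_R z w)) ∂wienerPair) →
  ∀ ω₂ lam β γ : ℝ, 0 < ω₂ → 0 < lam → 0 < β → 0 < γ →
  (∀ (N : ℕ) (T_L T_R : ℝ), 0 < T_L → 0 < T_R → ∀ μ ν : Measure (PhaseSpace N),
    (pinnedChain ω₂ lam β γ).IsSteadyState N T_L T_R μ →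
    (pinnedChain ω₂ lam β γ).IsSteadyState N T_L T_R ν → μ = ν) →
  ∀ (N : ℕ) (i0 : Fin N), 2 ≤ N → i0.val = 0 →
  ∀ (T_L T_R : ℝ), 0 < T_L → 0 < T_R → ∀ μ : Measure (PhaseSpace N),
    (pinnedChain ω₂ lam β γ).IsSteadyState N T_L T_R μ →
    0 ≤ (T_L - T_R) * ∫ x, x.2 i0 * partialQ i0 ((pinnedChain ω₂ lam β γ).hamiltonian N) x ∂μ := by
  intro hGDB ω₂ lam β γ hω hl hβ hγ huniq N i0 hN hi0 T_L T_R hTL hTR μ hμss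
  have hN1 : 1 < N := by omega
  have hN0 : 0 < N := by omega
  have hL1 := fun (ϑ : ℝ) (M : ℝ≥0∞) (hMtop : M ≠ ⊤) =>
    clausius_second_law_at_time hGDB hω hl hβ hγ i0 ⟨N - 1, by omega⟩ hN hi0 rfl hTL hTR
      (ϑ := ϑ) hMtop
  clear hGDB
  set P := pinnedChain ω₂ lam β γ with hP
  -- the constructed semigroup and its kernels
  set S := pinnedChainSemigroup hω hl.le hβ.le hγ.le hN0 hTL.le hTR.le with hS
  set κ := P.transitionKernel N T_L T_R with hκ
  haveI hκM : ∀ t, IsMarkovKernel (κ t) := fun t =>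
    pinnedChain_isMarkovKernel_transitionKernel hω hl.le hβ.le hγ.le N T_L T_R t
  -- the exponent of the Lyapunov observable
  have hTm : 0 < 1 / max T_L T_R := by positivity
  obtain ⟨ϑ, hϑ0, hϑ1, hϑR⟩ : ∃ ϑ : ℝ, 0 < ϑ ∧ ϑ < 1 / max T_L T_R ∧ ϑ < 1 / T_R :=
    ⟨1 / max T_L T_R / 2, by positivity, half_lt_self hTm,
      (half_lt_self hTm).trans_le (one_div_le_one_div_of_le hTR (le_max_right _ _))⟩
  -- the Gibbs start at `T_R`
  set ν : Measure (PhaseSpace N) := P.gibbsMeasure N T_R with hνdef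
  haveI hνP : IsProbabilityMeasure ν :=
    pinnedChain_isProbabilityMeasure_gibbsMeasure hω hl.le hβ.le γ N hTR
  have hνexp : Integrable (fun x => Real.exp (ϑ * P.hamiltonian N x)) ν :=
    pinnedChain_integrable_exp_mul_hamiltonian_gibbsMeasure hω hl.le hβ.le γ N hTR hϑR
  -- uniform exponential moments along the orbit of `ν` and polynomial bounds (helper 4)
  obtain ⟨M, hMtop, hM⟩ := clausius_orbit_exp_bound ω₂ lam β γ hω hl hβ hγ N hN1 T_L T_R hTL hTR ϑ
    hϑ0 hϑ1 ν hνexp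
  obtain ⟨K, hK⟩ := clausius_pointwise_bounds hω hl.le hβ.le γ N hϑ0 i0
  -- the Lyapunov observable `e^{ϑH}` in `ℝ≥0` form
  obtain ⟨V, hV⟩ : ∃ V : PhaseSpace N → ℝ≥0,
      V = fun x => (Real.exp (ϑ * P.hamiltonian N x)).toNNReal := ⟨_, rfl⟩
  have hVe : (fun x => (V x : ℝ≥0∞)) = fun x => ENNReal.ofReal (Real.exp (ϑ * P.hamiltonian N x)) := by
    subst hV; rfl
  have hVreal : ∀ x, (V x : ℝ) = Real.exp (ϑ * P.hamiltonian N x) := fun x => by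
    subst hV; exact Real.coe_toNNReal _ (Real.exp_pos _).le
  have hVc : Continuous V := by
    subst hV
    exact continuous_real_toNNReal.comp (Real.continuous_exp.comp
      (continuous_const.mul (pinnedChain_continuous_hamiltonian ω₂ lam β γ N)))
  have hVcpt : ∀ R : ℝ≥0, IsCompact {x | V x ≤ R} := fun R => by
    subst hV
    exact pinnedChain_isCompact_setOf_exp_le hω hl.le hβ.le γ N hϑ0 R
  have hMV : ∀ s : ℝ≥0, ∫⁻ y, (V y : ℝ≥0∞) ∂(ν.bind (κ s)) ≤ M := fun s => by
    rw [show (fun y => (V y : ℝ≥0∞)) = _ from hVe]; exact hM s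
  -- Krylov–Bogoliubov–Cesàro from `ν` (helper 2), and identification of the limit with `μ`
  have hadd : ∀ s t : ℝ≥0, κ (s + t) = (κ t).comp (κ s) := S.kernel_add
  obtain ⟨μ', hμ'P, hinv, hμ'V, φ, hφ, hlim⟩ := pinnedChain_exists_invariant_tendsto_cesaro N κ hadd
    S.measurable_kernel
    (fun t g => pinnedChain_continuous_integral_transitionKernel_bcf hω hl.le hβ.le hγ.le N T_L T_R t g)
    ν V hVc hVcpt M hMtop hMV
  have hμ'int : Integrable (fun x => Real.exp (ϑ * P.hamiltonian N x)) μ' := by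
    refine ⟨(Real.continuous_exp.comp (continuous_const.mul
      (pinnedChain_continuous_hamiltonian ω₂ lam β γ N))).aestronglyMeasurable, ?_⟩
    rw [hasFiniteIntegral_iff_ofReal (ae_of_all _ fun x => (Real.exp_pos _).le),
      show (fun x => ENNReal.ofReal (Real.exp (ϑ * P.hamiltonian N x))) = _ from hVe.symm]
    exact lt_of_le_of_lt hμ'V hMtop.lt_top
  have hμ'ss : P.IsSteadyState N T_L T_R μ' :=
    pinnedChain_isSteadyState_of_isInvariant hω.le hl.le hβ.le γ N S hinv hϑ0 hμ'int
  have hμeq : μ' = μ := huniq N T_L T_R hTL hTR μ' μ hμ'ss hμss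
  haveI hμP : IsProbabilityMeasure μ := hμeq ▸ hμ'P
  -- the Cesàro limit for the unbounded observable `ψ = p_0 ∂_{q_0}H` (helper 3)
  have hψc : Continuous fun y : PhaseSpace N => y.2 i0 * partialQ i0 (P.hamiltonian N) y :=
    ((continuous_apply i0).comp continuous_snd).mul
      (P.continuous_partialQ_hamiltonian (pinnedChain_contDiff_hamiltonian ω₂ lam β γ N) i0)
  have hψV : ∀ x : PhaseSpace N, (x.2 i0 * partialQ i0 (P.hamiltonian N) x) ^ 2 ≤ K * V x :=
    fun x => by rw [hVreal]; exact (hK x).2.2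
  have hKm : Measurable fun p : ℝ × PhaseSpace N => κ p.1.toNNReal p.2 := by
    have h := (pinnedChain_measurable_transitionKernel hω hl.le hβ.le hγ.le N T_L T_R).comp
      ((measurable_real_toNNReal.comp measurable_fst).prodMk measurable_snd)
    exact h
  have hρm : Measurable fun s : ℝ => ν.bind (κ s.toNNReal) := by
    refine Measure.measurable_of_measurable_coe _ fun A hA => ?_
    have h : (fun s : ℝ => (ν.bind (κ s.toNNReal)) A) = fun s => ∫⁻ x, κ s.toNNReal x A ∂ν := by
      funext s; exact Measure.bind_apply hA (Kernel.aemeasurable _)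
    rw [h]
    have hKA : Measurable fun p : ℝ × PhaseSpace N => κ p.1.toNNReal p.2 A :=
      (Measure.measurable_coe hA).comp hKm
    have h2 := hKA.lintegral_prod_right' (ν := ν)
    exact h2
  have hρP : ∀ s : ℝ, IsProbabilityMeasure (ν.bind (κ s.toNNReal)) := fun s => inferInstance
  have hμV : ∫⁻ y, (V y : ℝ≥0∞) ∂μ ≤ M := hμeq ▸ hμ'V
  have hlimψ : Tendsto (fun k => ((φ k : ℝ) + 1)⁻¹ *
      ∫ s in (0:ℝ)..((φ k : ℝ) + 1), ∫ y, y.2 i0 * partialQ i0 (P.hamiltonian N) y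
        ∂(ν.bind (κ s.toNNReal))) atTop
      (𝓝 (∫ x, x.2 i0 * partialQ i0 (P.hamiltonian N) x ∂μ)) :=
    pinnedChain_tendsto_cesaro_of_sq_le N _ hρm hρP μ V hVc M hMtop (fun s => hMV _) hμV φ
      (hμeq ▸ hlim) _ hψc K hψV
  -- steps (1)–(2): the second law at the times `t = φ k + 1`
  have hK' : ∀ x : PhaseSpace N, x.2 i0 ^ 2 ≤ K * Real.exp (ϑ * P.hamiltonian N x) ∧
      |x.2 i0 * partialQ i0 (P.hamiltonian N) x| ≤ K * Real.exp (ϑ * P.hamiltonian N x) :=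
    fun x => ⟨(hK x).1, (hK x).2.1⟩
  choose a b hab using fun k : ℕ =>
    hL1 ϑ M hMtop hM hK' (t := (φ k : ℝ) + 1) (by positivity)
  set c : ℝ := 1 / T_R - 1 / T_L with hcdef
  -- step (3): divide by `t` and pass to the limit
  have hsmall : Tendsto (fun k : ℕ => (a k - b k) / (2 * ((φ k : ℝ) + 1))) atTop (𝓝 0) := by
    have hbound : ∀ k : ℕ, ‖(a k - b k) / (2 * ((φ k : ℝ) + 1))‖ ≤ K * M.toReal / ((k : ℝ) + 1) := by
      intro k
      have hk : (k : ℝ) + 1 ≤ (φ k : ℝ) + 1 := by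
        have := hφ.id_le k
        exact_mod_cast Nat.succ_le_succ this
      have h1 := (hab k).1
      have h2 := (hab k).2.1
      rw [Real.norm_eq_abs, abs_div, abs_of_pos (by positivity : (0:ℝ) < 2 * ((φ k : ℝ) + 1)),
        div_le_div_iff₀ (by positivity) (by positivity)]
      have h3 : |a k - b k| ≤ 2 * (K * M.toReal) := (abs_sub _ _).trans (by linarith)
      have hk0 : (0 : ℝ) ≤ (k : ℝ) + 1 := by positivity
      calc |a k - b k| * ((k : ℝ) + 1) ≤ 2 * (K * M.toReal) * ((k : ℝ) + 1) :=
            mul_le_mul_of_nonneg_right h3 hk0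
        _ ≤ 2 * (K * M.toReal) * ((φ k : ℝ) + 1) := mul_le_mul_of_nonneg_left hk (by positivity)
        _ = K * M.toReal * (2 * ((φ k : ℝ) + 1)) := by ring
    refine squeeze_zero_norm hbound ?_
    have h := (tendsto_const_div_atTop_nhds_zero_nat ((K : ℝ) * M.toReal)).comp
      (tendsto_add_atTop_nat 1)
    refine h.congr fun n => ?_
    simp
  have hlim2 := (hsmall.add hlimψ).const_mul c
  have hnonneg : ∀ k : ℕ, 0 ≤ c * ((a k - b k) / (2 * ((φ k : ℝ) + 1)) +
      ((φ k : ℝ) + 1)⁻¹ * ∫ s in (0:ℝ)..((φ k : ℝ) + 1), ∫ y, y.2 i0 * partialQ i0 (P.hamiltonian N) y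
        ∂(ν.bind (κ s.toNNReal))) := by
    intro k
    have h := (hab k).2.2
    have hT : (0:ℝ) < (φ k : ℝ) + 1 := by positivity
    have hT' : (φ k : ℝ) + 1 ≠ 0 := hT.ne'
    have heq : c * ((a k - b k) / (2 * ((φ k : ℝ) + 1)) +
        ((φ k : ℝ) + 1)⁻¹ * ∫ s in (0:ℝ)..((φ k : ℝ) + 1), ∫ y, y.2 i0 * partialQ i0 (P.hamiltonian N) y
          ∂(ν.bind (κ s.toNNReal))) =
        ((φ k : ℝ) + 1)⁻¹ * (c * (a k / 2 - b k / 2 +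
          ∫ s in (0:ℝ)..((φ k : ℝ) + 1), ∫ y, y.2 i0 * partialQ i0 (P.hamiltonian N) y
            ∂(ν.bind (κ s.toNNReal)))) := by
      field_simp
    rw [heq]
    exact mul_nonneg (inv_nonneg.2 hT.le) h
  have hcψ : 0 ≤ c * ∫ x, x.2 i0 * partialQ i0 (P.hamiltonian N) x ∂μ := by
    have h0 := ge_of_tendsto' hlim2 hnonneg
    rwa [zero_add] at h0
  -- `T_L - T_R = T_L T_R (1/T_R - 1/T_L)`
  have hTR0 : T_R ≠ 0 := hTR.ne'
  have hTL0 : T_L ≠ 0 := hTL.ne'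
  have hfac : T_L - T_R = T_L * T_R * c := by
    rw [hcdef]; field_simp
  rw [hfac, mul_assoc]
  exact mul_nonneg (mul_nonneg hTL.le hTR.le) hcψ

end Summit.AtomisticToContinuum.FouriersLaw.Theorems.LinearResponseFTUR

end
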